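import Literature.Analysis.Complex.HalfPlaneDistortion
import Literature.Analysis.Complex.KoebeQuarterProofs
import Mathlib.MeasureTheory.Covering.Besicovitch
import Mathlib.MeasureTheory.Covering.BesicovitchVectorSpace
import Mathlib.MeasureTheory.Measure.Lebesgue.EqHaar
import Mathlib.MeasureTheory.Measure.Lebesgue.Complex
import HarnessLib

/-!
# Hölder boundary approach forces a null boundary: a porosity lemma for conformal maps of `ℍ`

Trunk T-STOCH support (complex analysis / measure theory). The classical fact behind
Rohde–Schramm's Corollary 5.3 (*Basic properties of SLE*, Ann. of Math. 161 (2005), §5: "the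
boundary of the image of a disk under a Hölder continuous conformal map has Hausdorff dimension
bounded away from 2 [Jones–Makarov 1995; Koskela–Rohde 1997] … In particular, a.s.
`area ∂Kₜ = 0`") in the weak form that is needed there — **zero area** rather than dimension
`< 2` — and under a weak, pointwise form of Hölder continuity, proved from Koebe's one-quarter
theorem, Koebe distortion and the Lebesgue density theorem:

* `ball_subset_image_upperHalfPlane` — Koebe's one-quarter theorem in the half-plane: for `f`
  holomorphic and injective on `ℍ` and `z ∈ ℍ`, `B(f(z), |f'(z)| im z / 4) ⊆ f(ℍ)`
  (`koebeQuarter_holds` on the disc `B(z, im z) ⊆ ℍ`).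
* `exists_ball_subset_image_of_norm_sub_le_rpow` (**porosity**) — let `w ∉ f(ℍ)` be approached
  Hölder-fast along a vertical line, `|f(x + iσ) - w| ≤ C σʰ` for `0 < σ ≤ 1` (`h > 0`). Then for
  every `s₀ ∈ (0, 1]` there is `σ ∈ (0, s₀]` with
  `B(f(x + iσ), ε_h |f(x + iσ) - w|) ⊆ f(ℍ)`, `ε_h = (1 - 2⁻ʰ)/16`. Otherwise, writing
  `F(σ) = |f(x + iσ) - w|`, Koebe 1/4 gives `σ|f'(x + iσ)| < 4 ε_h F(σ)`, Koebe distortion gives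
  `|f(x + iσ/2) - f(x + iσ)| ≤ 2σ |f'(x + iσ)| < 8 ε_h F(σ)`, and summing the dyadic telescoping
  series `F(σ) ≤ Σₖ |f(x + iσ2⁻ᵏ) - f(x + iσ2⁻ᵏ⁻¹)| ≤ 8 ε_h Σₖ F(σ 2⁻ᵏ)` improves `F(σ) ≤ C σʰ` to
  `F(σ) ≤ C σʰ/2`, hence to `F ≡ 0` by iteration — impossible since `w ∉ f(ℍ)`.
* `volume_eq_zero_of_norm_sub_le_rpow` (**null area**) — if `f(ℍ)` is open and every point of a
  set `S ⊆ ℂ ∖ f(ℍ)` is approached in this way along some vertical line, then `volume S = 0`: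
  at a point `w ∈ S` the holes `B(f(x + iσₙ), ε_h F(σₙ)) ⊆ B̄(w, 2F(σₙ)) ∖ (ℂ ∖ f(ℍ))`, `σₙ → 0`,
  keep the density of the closed set `ℂ ∖ f(ℍ)` at `w` below `1 - ε_h²/4` along `rₙ = 2F(σₙ) → 0`,
  so no point of `S` is a Lebesgue density point of `ℂ ∖ f(ℍ) ⊇ S`, and the Lebesgue density
  theorem (`Besicovitch.ae_tendsto_measure_inter_div_of_measurableSet`) makes `S` null.

For the SLE maps `fₜ = gₜ⁻¹` Rohde–Schramm's Thm. 5.2 provides `|f̂ₜ'(x + iy)| ≤ C(ω, t) yʰ⁻¹`,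
whence the vertical Hölder approach to every boundary value; this file is the deterministic half
of "Thm. 5.2 ⇒ Cor. 5.3".

## Mathlib

We USE `Besicovitch.ae_tendsto_measure_inter_div_of_measurableSet` (Lebesgue density theorem
for finite-dimensional real normed spaces), `MeasureTheory.Measure.addHaar_ball`,
`MeasureTheory.Measure.addHaar_closedBall_eq_addHaar_ball`, `Real.rpow`, geometric series
(`summable_geometric_of_lt_one`, `tsum_geometric_of_lt_one`). Koebe's theorems come from
`Literature/Analysis/Complex/KoebeDistortion.lean`, `KoebeQuarterProofs.lean`,
`HalfPlaneDistortion.lean` (Pommerenke (1992), Thm. 1.3; Lawler (2005), Thm. 3.17).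

## References

* S. Rohde, O. Schramm, *Basic properties of SLE*, Ann. of Math. 161 (2005), Thm. 5.2, Cor. 5.3.
* P. W. Jones, N. G. Makarov, *Density properties of harmonic measure*, Ann. of Math. 142 (1995),
  427–455; P. Koskela, S. Rohde, *Hausdorff dimension and mean porosity*, Math. Ann. 309 (1997),
  593–609 (the dimension versions); W. Smith, D. A. Stegenga, *Hölder domains and Poincaré
  domains*, Trans. Amer. Math. Soc. 319 (1990), 67–100.
* Ch. Pommerenke, *Boundary Behaviour of Conformal Maps*, Springer (1992), Thm. 1.3, Cor. 1.4.
-/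

noncomputable section

open Set Filter Topology Metric Complex MeasureTheory
open UpperHalfPlane (upperHalfPlaneSet isOpen_upperHalfPlaneSet)
open scoped ENNReal

namespace Literature.Analysis.Complex

open AreaThm

variable {f : ℂ → ℂ}

/-! ### Koebe's one-quarter theorem in the half-plane -/

/-- **Koebe 1/4 in the half-plane**: for `f` holomorphic and injective on `ℍ` and `z ∈ ℍ`,
`B(f(z), |f'(z)| im z / 4) ⊆ f(ℍ)` (Koebe's theorem `koebeQuarter_holds` for
`ζ ↦ f(z + (im z) ζ)` on the unit disc, whose image is `f(B(z, im z)) ⊆ f(ℍ)`).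
[cite: PommerenkeBBCM1992, Cor. 1.4] -/
theorem ball_subset_image_upperHalfPlane (hf : DifferentiableOn ℂ f upperHalfPlaneSet)
    (hinj : InjOn f upperHalfPlaneSet) {z : ℂ} (hz : 0 < z.im) :
    ball (f z) (‖deriv f z‖ * z.im / 4) ⊆ f '' upperHalfPlaneSet := by
  have hsub := ball_im_subset_upperHalfPlaneSet z
  obtain ⟨hFd, hFinj, hFderiv⟩ := rescale_ball hz (hf.mono hsub) (hinj.mono hsub)
  have hK := koebeQuarter_holds _ hFd hFinj
  have h0 : (0 : ℂ) ∈ ball (0 : ℂ) 1 := mem_ball_self one_pos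
  have hF0 : f (z + ((z.im : ℝ) : ℂ) * 0) = f z := by simp
  have hF0' : ‖deriv (fun ζ : ℂ ↦ f (z + (z.im : ℝ) * ζ)) 0‖ = ‖deriv f z‖ * z.im := by
    rw [hFderiv 0 h0, mul_zero, add_zero, norm_mul, Complex.norm_real, Real.norm_eq_abs,
      abs_of_pos hz, mul_comm]
  rw [hF0, hF0'] at hK
  refine hK.trans ?_
  rintro _ ⟨ζ, hζ, rfl⟩
  refine ⟨z + (z.im : ℝ) * ζ, hsub ?_, rfl⟩
  rw [mem_ball_zero_iff] at hζ
  rw [mem_ball, dist_eq_norm, add_sub_cancel_left, norm_mul, Complex.norm_real, Real.norm_eq_abs,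
    abs_of_pos hz]
  nlinarith

/-! ### Porosity at a boundary value approached Hölder-fast -/

/-- **Porosity lemma.** Let `f` be holomorphic and injective on `ℍ`, `w ∉ f(ℍ)`, and suppose
`|f(x + iσ) - w| ≤ C σʰ` for `0 < σ ≤ 1` (`h > 0`): the boundary value `w` is approached
Hölder-fast along the vertical line at `x`. Then for every `s₀ ∈ (0, 1]` there is `σ ∈ (0, s₀]`
such that the disc about `f(x + iσ)` of radius `ε_h |f(x + iσ) - w|`, `ε_h = (1 - 2⁻ʰ)/16`, lies
in `f(ℍ)`. (If not, Koebe 1/4 and Koebe distortion bound each dyadic increment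
`|f(x + iσ2⁻ᵏ⁻¹) - f(x + iσ2⁻ᵏ)|` by `8 ε_h |f(x + iσ2⁻ᵏ) - w|`, and summing the telescoping
series halves the constant in `|f(x + iσ) - w| ≤ C σʰ` again and again.) This is the mechanism
by which Hölder domains have porous, hence small, boundaries (Koskela–Rohde (1997);
Smith–Stegenga (1990)), in the pointwise form used for Rohde–Schramm (2005), Cor. 5.3.
[cite: RohdeSchramm2005, Cor 5.3 (proof)] -/
theorem exists_ball_subset_image_of_norm_sub_le_rpow (hf : DifferentiableOn ℂ f upperHalfPlaneSet)
    (hinj : InjOn f upperHalfPlaneSet) {w : ℂ} (hw : w ∉ f '' upperHalfPlaneSet) {x C h : ℝ}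
    (hh : 0 < h) (hH : ∀ σ : ℝ, 0 < σ → σ ≤ 1 → ‖f (x + σ * I) - w‖ ≤ C * σ ^ h)
    {s₀ : ℝ} (hs₀ : 0 < s₀) (hs₁ : s₀ ≤ 1) :
    ∃ σ : ℝ, 0 < σ ∧ σ ≤ s₀ ∧
      ball (f (x + σ * I)) ((1 - (2 : ℝ) ^ (-h)) / 16 * ‖f (x + σ * I) - w‖) ⊆
        f '' upperHalfPlaneSet := by
  -- notation and positivity
  set ρ : ℝ := (2 : ℝ) ^ (-h) with hρ_def
  have hρ0 : 0 < ρ := Real.rpow_pos_of_pos two_pos _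
  have hρ1 : ρ < 1 := Real.rpow_lt_one_of_one_lt_of_neg one_lt_two (neg_neg_of_pos hh)
  set ε : ℝ := (1 - ρ) / 16 with hε_def
  have hε : 0 < ε := by rw [hε_def]; linarith
  set z : ℝ → ℂ := fun σ ↦ (x : ℂ) + (σ : ℂ) * I with hz_def
  have hzim : ∀ σ, (z σ).im = σ := fun σ ↦ by simp [hz_def]
  set F : ℝ → ℝ := fun σ ↦ ‖f (z σ) - w‖ with hF_def
  have hFpos : ∀ σ, 0 < σ → 0 < F σ := by
    intro σ hσ
    refine norm_pos_iff.2 (sub_ne_zero.2 fun heq ↦ hw ⟨z σ, ?_, heq⟩)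
    show 0 < (z σ).im
    rw [hzim]; exact hσ
  by_contra H
  push Not at H
  -- Step 1: Koebe 1/4 makes the derivative small: `σ |f'(z σ)| < 4 ε F σ`
  have hder : ∀ σ, 0 < σ → σ ≤ s₀ → ‖deriv f (z σ)‖ * σ < 4 * (ε * F σ) := by
    intro σ hσ hσs
    by_contra hle
    rw [not_lt] at hle
    refine H σ hσ hσs ((ball_subset_ball ?_).trans
      (ball_subset_image_upperHalfPlane hf hinj (by rw [hzim]; exact hσ)))
    rw [hzim]
    linarith
  -- Step 2: Koebe distortion makes the dyadic increment small
  have hinc : ∀ σ, 0 < σ → σ ≤ s₀ → ‖f (z (σ / 2)) - f (z σ)‖ < 8 * (ε * F σ) := by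
    intro σ hσ hσs
    have hdist : ‖z (σ / 2) - z σ‖ ≤ (z σ).im / 2 := by
      rw [hzim]
      have : z (σ / 2) - z σ = ((σ / 2 - σ : ℝ) : ℂ) * I := by
        simp only [hz_def]; push_cast; ring
      rw [this, norm_mul, Complex.norm_I, mul_one, Complex.norm_real, Real.norm_eq_abs,
        show σ / 2 - σ = -(σ / 2) by ring, abs_neg, abs_of_pos (by positivity)]
    obtain ⟨-, -, h3⟩ := distortion_upperHalfPlane hf hinj (by rw [hzim]; exact hσ) hdist
    rw [hzim] at h3
    calc ‖f (z (σ / 2)) - f (z σ)‖ ≤ 2 * σ * ‖deriv f (z σ)‖ := h3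
      _ = 2 * (‖deriv f (z σ)‖ * σ) := by ring
      _ < 2 * (4 * (ε * F σ)) := mul_lt_mul_of_pos_left (hder σ hσ hσs) two_pos
      _ = 8 * (ε * F σ) := by ring
  -- dyadic points `σ 2⁻ᵏ`
  have hdy : ∀ (σ : ℝ) (k : ℕ), z (σ * 2⁻¹ ^ k / 2) = z (σ * 2⁻¹ ^ (k + 1)) := by
    intro σ k; simp only [hz_def]; push_cast; ring
  have hdy_pos : ∀ {σ : ℝ}, 0 < σ → ∀ k : ℕ, 0 < σ * 2⁻¹ ^ k := fun hσ k ↦ by positivity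
  have hdy_le : ∀ {σ : ℝ}, 0 < σ → σ ≤ s₀ → ∀ k : ℕ, σ * 2⁻¹ ^ k ≤ s₀ := fun hσ hσs k ↦
    (mul_le_of_le_one_right hσ.le (pow_le_one₀ (by norm_num) (by norm_num))).trans hσs
  have hrpow : ∀ (σ : ℝ), 0 < σ → ∀ k : ℕ, (σ * 2⁻¹ ^ k) ^ h = σ ^ h * ρ ^ k := by
    intro σ hσ k
    rw [Real.mul_rpow hσ.le (by positivity), ← Real.rpow_pow_comm (by norm_num), hρ_def,
      Real.rpow_neg zero_le_two, Real.inv_rpow zero_le_two]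
  -- the limit `f (z (σ 2⁻ᴺ)) → w`
  have hlim : ∀ σ, 0 < σ → σ ≤ s₀ →
      Tendsto (fun N : ℕ ↦ f (z (σ * 2⁻¹ ^ N))) atTop (𝓝 w) := by
    intro σ hσ hσs
    rw [tendsto_iff_norm_sub_tendsto_zero]
    have hgeo : Tendsto (fun N : ℕ ↦ C * σ ^ h * ρ ^ N) atTop (𝓝 0) := by
      simpa using (tendsto_pow_atTop_nhds_zero_of_lt_one hρ0.le hρ1).const_mul (C * σ ^ h)
    refine squeeze_zero (fun N ↦ norm_nonneg _) (fun N ↦ ?_) hgeo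
    calc ‖f (z (σ * 2⁻¹ ^ N)) - w‖ ≤ C * (σ * 2⁻¹ ^ N) ^ h :=
          hH _ (hdy_pos hσ N) ((hdy_le hσ hσs N).trans hs₁)
      _ = C * σ ^ h * ρ ^ N := by rw [hrpow σ hσ N, mul_assoc]
  -- Step 3: the constant in `F σ ≤ C σ^h` halves indefinitely
  have hind : ∀ m : ℕ, ∀ σ, 0 < σ → σ ≤ s₀ → F σ ≤ C * 2⁻¹ ^ m * σ ^ h := by
    intro m
    induction m with
    | zero =>
      intro σ hσ hσs
      simpa using hH σ hσ (hσs.trans hs₁)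
    | succ m ih =>
      intro σ hσ hσs
      -- finite telescoping bound
      have htel : ∀ N : ℕ, ‖f (z σ) - f (z (σ * 2⁻¹ ^ N))‖ ≤
          8 * ε * (C * 2⁻¹ ^ m * σ ^ h) * ∑ k ∈ Finset.range N, ρ ^ k := by
        intro N
        induction N with
        | zero => simp
        | succ N ihN =>
          have hstep : ‖f (z (σ * 2⁻¹ ^ N)) - f (z (σ * 2⁻¹ ^ (N + 1)))‖ ≤
              8 * ε * (C * 2⁻¹ ^ m * σ ^ h) * ρ ^ N := by
            rw [← hdy σ N, norm_sub_rev]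
            have h1 := hinc _ (hdy_pos hσ N) (hdy_le hσ hσs N)
            have h2 := ih _ (hdy_pos hσ N) (hdy_le hσ hσs N)
            rw [hrpow σ hσ N] at h2
            calc ‖f (z (σ * 2⁻¹ ^ N / 2)) - f (z (σ * 2⁻¹ ^ N))‖ ≤ 8 * (ε * F (σ * 2⁻¹ ^ N)) :=
                  h1.le
              _ ≤ 8 * (ε * (C * 2⁻¹ ^ m * (σ ^ h * ρ ^ N))) := by gcongr
              _ = 8 * ε * (C * 2⁻¹ ^ m * σ ^ h) * ρ ^ N := by ring
          calc ‖f (z σ) - f (z (σ * 2⁻¹ ^ (N + 1)))‖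
              ≤ ‖f (z σ) - f (z (σ * 2⁻¹ ^ N))‖ +
                  ‖f (z (σ * 2⁻¹ ^ N)) - f (z (σ * 2⁻¹ ^ (N + 1)))‖ := norm_sub_le_norm_sub_add_norm_sub _ _ _
            _ ≤ 8 * ε * (C * 2⁻¹ ^ m * σ ^ h) * ∑ k ∈ Finset.range N, ρ ^ k +
                  8 * ε * (C * 2⁻¹ ^ m * σ ^ h) * ρ ^ N := add_le_add ihN hstep
            _ = 8 * ε * (C * 2⁻¹ ^ m * σ ^ h) * ∑ k ∈ Finset.range (N + 1), ρ ^ k := by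
                  rw [Finset.sum_range_succ]; ring
      -- the geometric sums are `≤ (1 - ρ)⁻¹`
      have hC0 : 0 ≤ C * 2⁻¹ ^ m * σ ^ h := by
        have := (hFpos σ hσ).le.trans (ih σ hσ hσs)
        exact this
      have hgeom : ∀ N : ℕ, ∑ k ∈ Finset.range N, ρ ^ k ≤ (1 - ρ)⁻¹ := fun N ↦ by
        rw [← tsum_geometric_of_lt_one hρ0.le hρ1]
        exact (summable_geometric_of_lt_one hρ0.le hρ1).sum_le_tsum _ fun k _ ↦ by positivity
      have hbound : ∀ N : ℕ, ‖f (z σ) - f (z (σ * 2⁻¹ ^ N))‖ ≤ C * 2⁻¹ ^ (m + 1) * σ ^ h := by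
        intro N
        calc ‖f (z σ) - f (z (σ * 2⁻¹ ^ N))‖
            ≤ 8 * ε * (C * 2⁻¹ ^ m * σ ^ h) * ∑ k ∈ Finset.range N, ρ ^ k := htel N
          _ ≤ 8 * ε * (C * 2⁻¹ ^ m * σ ^ h) * (1 - ρ)⁻¹ := by gcongr; exact hgeom N
          _ = C * 2⁻¹ ^ (m + 1) * σ ^ h := by
                have h1ρ : (1 : ℝ) - ρ ≠ 0 := by linarith
                rw [hε_def, pow_succ]
                field_simp
                ring
      -- pass to the limit `N → ∞`
      have htend : Tendsto (fun N : ℕ ↦ ‖f (z σ) - f (z (σ * 2⁻¹ ^ N))‖) atTop (𝓝 (F σ)) :=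
        (tendsto_const_nhds.sub (hlim σ hσ hσs)).norm
      exact le_of_tendsto' htend hbound
  -- Step 4: contradiction at `σ = s₀`
  have hlim0 : Tendsto (fun m : ℕ ↦ C * 2⁻¹ ^ m * s₀ ^ h) atTop (𝓝 0) := by
    have := (tendsto_pow_atTop_nhds_zero_of_lt_one (by norm_num : (0 : ℝ) ≤ 2⁻¹)
      (by norm_num : (2⁻¹ : ℝ) < 1)).const_mul C
    simpa [mul_comm, mul_assoc, mul_left_comm] using this.mul_const (s₀ ^ h)
  have hle : F s₀ ≤ 0 := ge_of_tendsto' hlim0 fun m ↦ hind m s₀ hs₀ le_rfl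
  exact absurd hle (not_le.2 (hFpos s₀ hs₀))

/-! ### From porosity to zero area -/

/-- **A hole of proportional size spoils density.** If `w ∉ Ω`, `Ω` open, and along radii
`rₙ → 0⁺` there are discs `B(wₙ, c rₙ) ⊆ Ω ∩ B̄(w, rₙ)` (`0 < c`), then the density ratio
`volume (ℂ ∖ Ω ∩ B̄(w, r)) / volume B̄(w, r)` does not tend to `1` as `r → 0⁺`. [folklore] -/
theorem not_tendsto_density_of_holes {Ω : Set ℂ} {w : ℂ} {c : ℝ} (hc : 0 < c)
    {r : ℕ → ℝ} {v : ℕ → ℂ} (hr : ∀ n, 0 < r n) (hr0 : Tendsto r atTop (𝓝 0))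
    (hball : ∀ n, ball (v n) (c * r n) ⊆ Ω ∩ closedBall w (r n)) :
    ¬ Tendsto (fun ρ : ℝ ↦ volume (Ωᶜ ∩ closedBall w ρ) / volume (closedBall w ρ))
      (𝓝[>] 0) (𝓝 1) := by
  intro hT
  have hr' : Tendsto r atTop (𝓝[>] 0) :=
    tendsto_nhdsWithin_iff.2 ⟨hr0, Eventually.of_forall fun n ↦ hr n⟩
  have hseq := hT.comp hr'
  -- the ratio along `rₙ` is at most `1 - c²`
  set c₀ : ℝ≥0∞ := volume (ball (0 : ℂ) 1) with hc₀
  have hc₀0 : c₀ ≠ 0 := (measure_ball_pos volume (0 : ℂ) one_pos).ne'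
  have hc₀T : c₀ ≠ ⊤ := measure_ball_lt_top.ne
  have hbound : ∀ n, volume (Ωᶜ ∩ closedBall w (r n)) / volume (closedBall w (r n)) ≤
      1 - ENNReal.ofReal (c ^ 2) := by
    intro n
    have hrn : 0 < r n := hr n
    have hB : volume (closedBall w (r n)) = ENNReal.ofReal (r n ^ 2) * c₀ := by
      rw [Measure.addHaar_closedBall_eq_addHaar_ball, Measure.addHaar_ball _ _ (hr n).le,
        Complex.finrank_real_complex]
    have hb : volume (ball (v n) (c * r n)) = ENNReal.ofReal ((c * r n) ^ 2) * c₀ := by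
      rw [Measure.addHaar_ball _ _ (by positivity : 0 ≤ c * r n), Complex.finrank_real_complex]
    have hsub : Ωᶜ ∩ closedBall w (r n) ⊆ closedBall w (r n) \ ball (v n) (c * r n) := by
      rintro u ⟨huΩ, hu⟩
      exact ⟨hu, fun hub ↦ huΩ (hball n hub).1⟩
    have hballsub : ball (v n) (c * r n) ⊆ closedBall w (r n) := fun u hu ↦ (hball n hu).2
    have hBpos : ENNReal.ofReal (r n ^ 2) ≠ 0 := by
      rw [ENNReal.ofReal_ne_zero_iff]; exact pow_pos (hr n) 2
    have hBtop : volume (closedBall w (r n)) ≠ ⊤ := measure_closedBall_lt_top.ne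
    calc volume (Ωᶜ ∩ closedBall w (r n)) / volume (closedBall w (r n))
        ≤ volume (closedBall w (r n) \ ball (v n) (c * r n)) / volume (closedBall w (r n)) := by
          gcongr
      _ = (volume (closedBall w (r n)) - volume (ball (v n) (c * r n))) /
            volume (closedBall w (r n)) := by
          rw [measure_sdiff hballsub measurableSet_ball.nullMeasurableSet
            (measure_ball_lt_top (μ := volume)).ne]
      _ = 1 - volume (ball (v n) (c * r n)) / volume (closedBall w (r n)) := by
          rw [ENNReal.sub_div fun _ _ ↦ (measure_closedBall_pos volume w (hr n)).ne',
            ENNReal.div_self (measure_closedBall_pos volume w (hr n)).ne' hBtop]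
      _ = 1 - ENNReal.ofReal (c ^ 2) := by
          rw [hb, hB, ENNReal.mul_div_mul_right _ _ hc₀0 hc₀T, mul_pow,
            ENNReal.ofReal_mul (sq_nonneg c),
            ENNReal.mul_div_cancel_right hBpos ENNReal.ofReal_ne_top]
  have hlt : (1 : ℝ≥0∞) - ENNReal.ofReal (c ^ 2) < 1 :=
    ENNReal.sub_lt_self ENNReal.one_ne_top one_ne_zero
      (by rw [ENNReal.ofReal_ne_zero_iff]; positivity)
  have := le_of_tendsto' hseq (fun n ↦ hbound n)
  exact absurd this (not_le.2 hlt)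

/-- **Hölder boundary approach forces zero area.** Let `f` be holomorphic and injective on `ℍ`
with open image `Ω = f(ℍ)`, and let `S ⊆ ℂ ∖ Ω` be a set each of whose points `w` is approached
Hölder-fast along some vertical line: `|f(x + iσ) - w| ≤ C σʰ` for `0 < σ ≤ 1`, some `x ∈ ℝ`,
`C`, `h > 0`. Then `volume S = 0`. Proof: by the porosity lemma
(`exists_ball_subset_image_of_norm_sub_le_rpow`) every `w ∈ S` sees holes
`B(f(x + iσₙ), ε_h F(σₙ)) ⊆ Ω ∩ B̄(w, 2F(σₙ))`, `F(σₙ) = |f(x + iσₙ) - w| → 0`, so `w` is not a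
Lebesgue density point of the closed set `ℂ ∖ Ω` (`not_tendsto_density_of_holes`), and the set
of such points is null (`Besicovitch.ae_tendsto_measure_inter_div_of_measurableSet`). This is
the zero-area content of "the boundary of the image of a disk under a Hölder continuous conformal
map has Hausdorff dimension bounded away from 2" used in Rohde–Schramm (2005), Cor. 5.3.
[cite: RohdeSchramm2005, Cor 5.3 (proof)] -/
theorem volume_eq_zero_of_norm_sub_le_rpow (hf : DifferentiableOn ℂ f upperHalfPlaneSet)
    (hinj : InjOn f upperHalfPlaneSet) (hΩ : IsOpen (f '' upperHalfPlaneSet)) {S : Set ℂ}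
    (hS : ∀ w ∈ S, w ∉ f '' upperHalfPlaneSet ∧ ∃ x C h : ℝ, 0 < h ∧
      ∀ σ : ℝ, 0 < σ → σ ≤ 1 → ‖f (x + σ * I) - w‖ ≤ C * σ ^ h) :
    volume S = 0 := by
  set Ω : Set ℂ := f '' upperHalfPlaneSet with hΩ_def
  have hD := Besicovitch.ae_tendsto_measure_inter_div_of_measurableSet (volume : Measure ℂ)
    hΩ.isClosed_compl.measurableSet
  refine measure_mono_null (fun w hw ↦ ?_) (ae_iff.1 hD)
  obtain ⟨hwΩ, x, C, h, hh, hH⟩ := hS w hw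
  have hind : (Ωᶜ).indicator (1 : ℂ → ℝ≥0∞) w = 1 := by
    rw [indicator_of_mem (show w ∈ Ωᶜ from hwΩ), Pi.one_apply]
  rw [mem_setOf_eq, hind]
  -- holes along `σₙ ≤ 1/(n+1)`
  set ε : ℝ := (1 - (2 : ℝ) ^ (-h)) / 16 with hε_def
  have hρ1 : (2 : ℝ) ^ (-h) < 1 := Real.rpow_lt_one_of_one_lt_of_neg one_lt_two (neg_neg_of_pos hh)
  have hε : 0 < ε := by rw [hε_def]; linarith
  have hε1 : ε ≤ 1 := by
    rw [hε_def]; linarith [Real.rpow_pos_of_pos two_pos (-h)]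
  have hex : ∀ n : ℕ, ∃ σ : ℝ, 0 < σ ∧ σ ≤ 1 / ((n : ℝ) + 1) ∧
      ball (f (x + σ * I)) (ε * ‖f (x + σ * I) - w‖) ⊆ Ω := fun n ↦
    exists_ball_subset_image_of_norm_sub_le_rpow hf hinj hwΩ hh hH (by positivity)
      (by rw [div_le_one (by positivity)]; linarith [n.cast_nonneg (α := ℝ)])
  choose σ hσ hσn hσball using hex
  set F : ℕ → ℝ := fun n ↦ ‖f (x + σ n * I) - w‖ with hF_def
  have hFpos : ∀ n, 0 < F n := by
    intro n
    refine norm_pos_iff.2 (sub_ne_zero.2 fun heq ↦ hwΩ ⟨x + σ n * I, ?_, heq⟩)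
    show 0 < ((x : ℂ) + (σ n : ℂ) * I).im
    simpa using hσ n
  have hF0 : Tendsto F atTop (𝓝 0) := by
    have hσ0 : Tendsto σ atTop (𝓝 0) :=
      squeeze_zero (fun n ↦ (hσ n).le) hσn tendsto_one_div_add_atTop_nhds_zero_nat
    have hpow : Tendsto (fun n ↦ C * σ n ^ h) atTop (𝓝 0) := by
      have h1 : Tendsto (fun n ↦ σ n ^ h) atTop (𝓝 0) := by
        have := (Real.continuousAt_rpow_const 0 h (Or.inr hh.le)).tendsto.comp hσ0
        simpa [Function.comp_def, Real.zero_rpow hh.ne'] using this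
      simpa using h1.const_mul C
    refine squeeze_zero (fun n ↦ norm_nonneg _) (fun n ↦ ?_) hpow
    exact hH _ (hσ n) ((hσn n).trans (by
      rw [div_le_one (by positivity)]; linarith [n.cast_nonneg (α := ℝ)]))
  -- apply the density criterion with radii `2 F n` and holes of radius `ε F n = (ε/2) (2 F n)`
  refine not_tendsto_density_of_holes (c := ε / 2) (by positivity)
    (r := fun n ↦ 2 * F n) (v := fun n ↦ f (x + σ n * I)) (fun n ↦ mul_pos two_pos (hFpos n))
    (by simpa using hF0.const_mul 2) fun n ↦ ?_
  have hrad : ε / 2 * (2 * F n) = ε * ‖f (x + σ n * I) - w‖ := by rw [hF_def]; ring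
  rw [hrad]
  refine subset_inter (hσball n) fun u hu ↦ ?_
  rw [mem_ball] at hu
  rw [mem_closedBall]
  calc dist u w ≤ dist u (f (x + σ n * I)) + dist (f (x + σ n * I)) w := dist_triangle _ _ _
    _ ≤ ε * ‖f (x + σ n * I) - w‖ + ‖f (x + σ n * I) - w‖ := by
        rw [dist_eq_norm (f _) w]; exact add_le_add hu.le le_rfl
    _ ≤ 1 * ‖f (x + σ n * I) - w‖ + ‖f (x + σ n * I) - w‖ := by gcongr
    _ = 2 * F n := by rw [hF_def]; ring

end Literature.Analysis.Complex

end
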